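import Summits.ValiantsHypothesis.ValiantsHypothesis.Theorems.LacunarySymmetroidMatrixDescartesCensusTable
import Summits.ValiantsHypothesis.ValiantsHypothesis.Theorems.LacunarySymmetroidMatrixDescartesCensusM2K5K13
import Summits.ValiantsHypothesis.ValiantsHypothesis.Theorems.LacunarySymmetroidMatrixDescartesCensusM3K4S6
import Summits.ValiantsHypothesis.ValiantsHypothesis.Theorems.LacunarySymmetroidMatrixDescartesCensusM4K4E1
import Summits.ValiantsHypothesis.ValiantsHypothesis.Theorems.LacunarySymmetroidMatrixDescartesCensusM3K5E1

/-!
# `MatrixDescartes` — census NO-GO records: the cell's candidate sharp laws `T`, `T′`, `L2` are FALSE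

HONEST FRAMING.  Object-search cell `pub-symmetroid`, crux `Theses.LacunarySymmetroid.MatrixDescartes`
(stmt-ValiantsHypothesis-18050).  This file records, as plain negations in the kernel (no new definitions: a dead
law gets no permanent name), that three candidate SHARP laws for `ζ(m,K)` — the maximal number of distinct positive
real zeros of `det (∑ l, X^(d l) • S l)` over `K`-term real symmetric `m × m` pencils — which the cell entertained
on 2026-08-22 are refuted by certified census rows:
* `T`  («dimension law», `ζ = K·m(m+1)/2 − m²`, capped by Descartes): dead at `(2,4)` — predicts `8`, but
  `ζ(2,4) = 9` (tree witness `W24`, `Census.posRootLaw_two_four_sharp`);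
* `T′` («dimension + 1», lead R17c/R18: `min(D, dim X − 1) ≤ ζ ≤ min(D, dim X)` with `dim X = K·m(m+1)/2 − m² + 1`):
  dead at `(2,5)` — predicts `ζ(2,5) ≤ 12`, but `ζ(2,5) ≥ 13` (engine-1's kill row, `Census.M2K5K13`);
* `L2` (lead R18, typed shape endorsed R21: `ζ(2,K) = 3K − 3` for `K ≥ 4`): dead at `K = 5` by the same row
  (and at `K = 6` by `ζ(2,6) ≥ 16`, engine-1 `E1-S-2-6-BUMP16-1613-00`, not yet a kernel row).
The cell's INBOX/CENSUS.md (lead R25, 2026-08-22T16:58Z) carries the same verdicts; the frame of record after the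
kills is `CONJECTURE.md v1.5` (A3 for the `K = 3` column, Conjecture B = `Census.KPlusLogSqLaw`).  Also packaged
here: the kernel BOUNDS of the four thin formats that now have a certificate, `bounds_m_K : ¬ PosRootLawAt m K (L−1) ∧
PosRootLawAt m K D` (`L ≤ ζ(m,K) ≤ D`, lower half = certificate, upper half = Descartes ceiling).  Finite data; no
bearing on the asymptotic crux except as pattern evidence; nothing about `VP ≠ VNP`.
-/

-- `Summit.ValiantsHypothesis.ValiantsHypothesis.…` repeats a component by the D-0017 layout
-- (single-conjunct summit), which the `dupNamespace` linter flags; the name is mandated.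
set_option linter.dupNamespace false

namespace Summit.ValiantsHypothesis.ValiantsHypothesis.Theorems.LacunarySymmetroidMatrixDescartes.Census

open Summit.ValiantsHypothesis.ValiantsHypothesis.Theorems.MatrixDescartes.Negative (PosRootLawAt)

/-! ## Bounds of record for the thin formats with a kernel certificate -/

/-- **`13 ≤ ζ(2,5) ≤ 14`** (`M2K5K13` / Descartes `C(6,2) − 1`). [folklore] -/
theorem bounds_2_5 : ¬ PosRootLawAt 2 5 12 ∧ PosRootLawAt 2 5 14 :=
  ⟨M2K5K13.not_posRootLawAt, posRootLawAt_of_eq (by norm_num) (by decide)⟩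

/-- **`16 ≤ ζ(3,4) ≤ 19`** (`M3K4S6` / Descartes `C(6,3) − 1`). [folklore] -/
theorem bounds_3_4 : ¬ PosRootLawAt 3 4 15 ∧ PosRootLawAt 3 4 19 :=
  ⟨M3K4S6.not_posRootLawAt, posRootLawAt_of_eq (by norm_num) (by decide)⟩

/-- **`21 ≤ ζ(4,4) ≤ 34`** (`M4K4E1` / Descartes `C(7,4) − 1`). [folklore] -/
theorem bounds_4_4 : ¬ PosRootLawAt 4 4 20 ∧ PosRootLawAt 4 4 34 :=
  ⟨M4K4E1.not_posRootLawAt, posRootLawAt_of_eq (by norm_num) (by decide)⟩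

/-- **`20 ≤ ζ(3,5) ≤ 34`** (`M3K5E1` / Descartes `C(7,3) − 1`). [folklore] -/
theorem bounds_3_5 : ¬ PosRootLawAt 3 5 19 ∧ PosRootLawAt 3 5 34 :=
  ⟨M3K5E1.not_posRootLawAt, posRootLawAt_of_eq (by norm_num) (by decide)⟩

/-! ## NO-GO records -/

/-- **NO-GO `T` (the «dimension law» `ζ(m,K) = min(D(m,K), K·m(m+1)/2 − m²)`)**: its upper half already fails at
`(m,K) = (2,4)`, where it predicts `8 = min(9, 8)` but the tree witness `W24` has `9` positive zeros.  Stated for the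
upper-bound clause alone (the strongest refutation). [folklore] -/
theorem noGo_dimensionLaw :
    ¬ (∀ m K : ℕ, 1 ≤ m → 2 ≤ K →
        PosRootLawAt m K (min (Nat.choose (m + K - 1) m - 1) (K * (m * (m + 1) / 2) - m ^ 2))) := by
  intro h
  exact posRootLaw_two_four_sharp.2 (by simpa [Nat.choose] using h 2 4 (by norm_num) (by norm_num))

/-- **NO-GO `T′` (lead R17c/R18 «dimension + 1» law: `min(D, dim X − 1) ≤ ζ(m,K) ≤ min(D, dim X)`,
`dim X_sym(m,K) = K·m(m+1)/2 − m² + 1`)**: its upper half fails at `(2,5)`, where `min(14, 12) = 12` but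
`ζ(2,5) ≥ 13` (`Census.M2K5K13`, engine-1's kill row `E1-S-2-5-KILL13`).  Upper-bound clause alone. [folklore] -/
theorem noGo_dimensionPlusOneLaw :
    ¬ (∀ m K : ℕ, 1 ≤ m → 2 ≤ K →
        PosRootLawAt m K (min (Nat.choose (m + K - 1) m - 1) (K * (m * (m + 1) / 2) - m ^ 2 + 1))) := by
  intro h
  exact M2K5K13.not_posRootLawAt (by simpa [Nat.choose] using h 2 5 (by norm_num) (by norm_num))

/-- The two-sided `T′` shape (as drafted for typing on 2026-08-22, never proposed as a definition) is refuted
a fortiori. [folklore] -/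
theorem noGo_dimensionPlusOneLaw' :
    ¬ (∀ m K : ℕ, 1 ≤ m → 2 ≤ K →
        PosRootLawAt m K (min (Nat.choose (m + K - 1) m - 1) (K * (m * (m + 1) / 2) - m ^ 2 + 1)) ∧
        ¬ PosRootLawAt m K (min (Nat.choose (m + K - 1) m - 1) (K * (m * (m + 1) / 2) - m ^ 2) - 1)) :=
  fun h => noGo_dimensionPlusOneLaw fun m K hm hK => (h m K hm hK).1

/-- **NO-GO `L2` (lead R18; typed shape endorsed in R21: `∀ K ≥ 4, ζ(2,K) = 3K − 3`)**: the upper half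
`ζ(2,K) ≤ 3K − 3` fails at `K = 5` (`3·5 − 3 = 12 < 13 ≤ ζ(2,5)`, `Census.M2K5K13`).  The LOWER half
`ζ(2,K) ≥ 3K − 3` stays true for `K = 4 … 7` (`Census.l2_lower_four_to_seven`).  Upper-bound clause alone. [folklore] -/
theorem noGo_twoByTwoLaw : ¬ (∀ K : ℕ, 4 ≤ K → PosRootLawAt 2 K (3 * K - 3)) := by
  intro h
  exact M2K5K13.not_posRootLawAt (by simpa using h 5 (by norm_num))

/-- The exact R21-endorsed shape of `L2` (`PosRootLawAt 2 K (3K−3) ∧ ¬ PosRootLawAt 2 K (3K−4)` for all `K ≥ 4`)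
is refuted a fortiori. [folklore] -/
theorem noGo_twoByTwoLaw' :
    ¬ (∀ K : ℕ, 4 ≤ K → PosRootLawAt 2 K (3 * K - 3) ∧ ¬ PosRootLawAt 2 K (3 * K - 4)) :=
  fun h => noGo_twoByTwoLaw fun K hK => (h K hK).1

end Summit.ValiantsHypothesis.ValiantsHypothesis.Theorems.LacunarySymmetroidMatrixDescartes.Census
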